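import Mathlib
import HarnessLib

/-!
# Power-sum products `p_μ = Π_{k ∈ μ} p_k` form a basis of the homogeneous symmetric polynomials
(crux `OrbitRestorationQP`, stmt-ValiantsHypothesis-18293 — lane SML: the column-set-multilinear `ΣΠΣ` stratum of A_∞)

For the narrowness lemma of the set-multilinear stratum (blueprint `SML-STRATUM-BLUEPRINT.md`, evidence on the
crux item) we need, over `ℂ` and in `n` variables:

* `psumProd_linearIndependent` — for `d ≤ n`, the products `(μ.map (psum (Fin n) ℂ)).prod` over DISTINCT multisets
  `μ` of positive integers with `μ.sum = d` are linearly independent (peeling proof: specialise the first variable to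
  `t` with `MvPolynomial.finSuccEquiv`, read off the coefficient of `t^{k₀}` for the least part `k₀` in play, induct on `d`);
* `exists_psumProd_expansion` — every symmetric homogeneous polynomial of degree `d` is a `ℂ`-combination of such
  products (Mathlib's fundamental theorem `esymmAlgHom_surjective` + Newton's identities `mul_esymm_eq_sum`
  + a homogeneous-component filter).

Def-free; multisets of positive naturals stand in for `Nat.Partition` to keep re-indexing light. [folklore]
-/

set_option linter.dupNamespace false

namespace Summit.ValiantsHypothesis.ValiantsHypothesis.Theorems.SmlPowerSums

open MvPolynomial

/-! ### The specialisation `y_0 ↦ t` on power sums -/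

/-- `finSuccEquiv` sends the power sum `p_k` in `n+1` variables to `t^k + p_k` (the latter in `n` variables, as a
constant of the polynomial ring in `t`). [folklore] -/
theorem finSuccEquiv_psum (n k : ℕ) :
    finSuccEquiv ℂ n (psum (Fin (n + 1)) ℂ k) =
      Polynomial.X ^ k + Polynomial.C (psum (Fin n) ℂ k) := by
  simp only [psum, map_sum, map_pow, map_add, Fin.sum_univ_succ, finSuccEquiv_X_zero, finSuccEquiv_X_succ]

/-- The constant coefficient of `Π_{l ∈ ν} (t^l + C (g l))` is `Π_{l ∈ ν} g l` when all `l ∈ ν` are positive. [folklore] -/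
theorem coeff_zero_prod_X_pow_add_C {A : Type*} [CommRing A] (g : ℕ → A) :
    ∀ (ν : Multiset ℕ), (∀ l ∈ ν, 0 < l) →
      ((ν.map fun l => (Polynomial.X ^ l + Polynomial.C (g l) : Polynomial A)).prod).coeff 0 =
        (ν.map g).prod := by
  intro ν
  induction ν using Multiset.induction_on with
  | empty => intro _; simp
  | cons l ν ih =>
    intro hν
    have hl : 0 < l := hν l (Multiset.mem_cons_self _ _)
    have hν' : ∀ l' ∈ ν, 0 < l' := fun l' hl' => hν l' (Multiset.mem_cons_of_mem hl')
    rw [Multiset.map_cons, Multiset.prod_cons, Multiset.map_cons, Multiset.prod_cons,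
      Polynomial.coeff_zero_eq_eval_zero, Polynomial.eval_mul, ← Polynomial.coeff_zero_eq_eval_zero,
      ← Polynomial.coeff_zero_eq_eval_zero, ih hν']
    have h0l : (0 : ℕ) ≠ l := hl.ne
    simp [h0l]

/-- The coefficient of `t^{k₀}` in `Π_{l ∈ ν} (t^l + C (g l))`, when every `l ∈ ν` is `≥ k₀ ≥ 1`, is
`count k₀ ν · Π_{l ∈ ν.erase k₀} g l`: the power `t^{k₀}` can only come from a single factor with `l = k₀`. [folklore] -/
theorem coeff_prod_X_pow_add_C {A : Type*} [CommRing A] (g : ℕ → A) (k₀ : ℕ) (hk₀ : 0 < k₀) :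
    ∀ (ν : Multiset ℕ), (∀ l ∈ ν, k₀ ≤ l) →
      ((ν.map fun l => (Polynomial.X ^ l + Polynomial.C (g l) : Polynomial A)).prod).coeff k₀ =
        (ν.count k₀ : A) * ((ν.erase k₀).map g).prod := by
  intro ν
  induction ν using Multiset.induction_on with
  | empty => intro _; simp [Polynomial.coeff_one, hk₀.ne']
  | cons l ν ih =>
    intro hν
    have hl : k₀ ≤ l := hν l (Multiset.mem_cons_self _ _)
    have hν' : ∀ l' ∈ ν, k₀ ≤ l' := fun l' hl' => hν l' (Multiset.mem_cons_of_mem hl')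
    have hpos : ∀ l' ∈ ν, 0 < l' := fun l' hl' => lt_of_lt_of_le hk₀ (hν' l' hl')
    rw [Multiset.map_cons, Multiset.prod_cons, add_mul, Polynomial.coeff_add,
      Polynomial.coeff_C_mul, ih hν', Polynomial.coeff_X_pow_mul']
    rcases eq_or_lt_of_le hl with rfl | hlt
    · -- the factor `t^{k₀} + C (g k₀)` itself
      simp only [le_refl, if_true, Nat.sub_self, coeff_zero_prod_X_pow_add_C g ν hpos,
        Multiset.count_cons_self, Multiset.erase_cons_head, Nat.cast_add, Nat.cast_one]
      rcases Decidable.em (k₀ ∈ ν) with hmem | hmem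
      · have hsplit : (ν.map g).prod = g k₀ * ((ν.erase k₀).map g).prod := by
          conv_lhs => rw [← Multiset.cons_erase hmem]
          rw [Multiset.map_cons, Multiset.prod_cons]
        simp only [hsplit]
        ring
      · rw [Multiset.count_eq_zero_of_notMem hmem, Multiset.erase_of_notMem hmem]
        simp
    · have hne : l ≠ k₀ := Nat.ne_of_gt hlt
      rw [if_neg (not_le.mpr hlt), zero_add, Multiset.count_cons_of_ne hne.symm,
        Multiset.erase_cons_tail ν hne, Multiset.map_cons, Multiset.prod_cons]
      ring

/-! ### Linear independence of the power-sum products -/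

/-- **Linear independence of `{p_μ : μ ⊢ d}` in `n ≥ d` variables.**  For a finite set `S` of DISTINCT multisets of
positive integers, all of sum `d ≤ n`, a vanishing `ℂ`-combination of the products `Π_{k ∈ μ} p_k` in
`MvPolynomial (Fin n) ℂ` has all coefficients zero. [folklore] -/
theorem psumProd_linearIndependent :
    ∀ (d n : ℕ), d ≤ n → ∀ (S : Finset (Multiset ℕ)) (c : Multiset ℕ → ℂ),
      (∀ μ ∈ S, (∀ k ∈ μ, 0 < k) ∧ μ.sum = d) →
      ∑ μ ∈ S, c μ • (μ.map (psum (Fin n) ℂ)).prod = 0 → ∀ μ ∈ S, c μ = 0 := by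
  intro d
  induction d using Nat.strong_induction_on with
  | _ d ih =>
    intro n hdn S c hS hsum
    by_contra hne
    simp only [not_forall] at hne
    obtain ⟨μ₀, hμ₀S, hμ₀⟩ := hne
    -- the parts in play: all parts of the multisets with a nonzero coefficient
    set S' : Finset (Multiset ℕ) := S.filter fun μ => c μ ≠ 0 with hS'def
    have hμ₀S' : μ₀ ∈ S' := Finset.mem_filter.2 ⟨hμ₀S, hμ₀⟩
    rcases Nat.eq_zero_or_pos d with rfl | hdpos
    · -- `d = 0`: every multiset in `S` is empty, so `S = {0}` and the relation reads `c 0 = 0`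
      have hall : ∀ μ ∈ S, μ = 0 := by
        intro μ hμ
        obtain ⟨hpos, hs⟩ := hS μ hμ
        rw [Multiset.sum_eq_zero_iff] at hs
        rcases Multiset.empty_or_exists_mem μ with h | ⟨k, hk⟩
        · exact h
        · exact absurd (hs k hk) (hpos k hk).ne'
      have hSeq : S = {0} := by
        ext μ
        constructor
        · intro hμ; rw [Finset.mem_singleton]; exact hall μ hμ
        · intro hμ; rw [Finset.mem_singleton] at hμ; rw [hμ, ← hall μ₀ hμ₀S]; exact hμ₀S
      rw [hSeq, Finset.sum_singleton] at hsum
      simp only [Multiset.map_zero, Multiset.prod_zero, smul_eq_zero, one_ne_zero, or_false] at hsum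
      exact hμ₀ ((hall μ₀ hμ₀S) ▸ hsum)
    -- `d > 0`: there is a variable to peel
    obtain ⟨n', rfl⟩ : ∃ n', n = n' + 1 := ⟨n - 1, by omega⟩
    set parts : Finset ℕ := S'.biUnion fun μ => μ.toFinset with hparts
    have hμ₀ne : μ₀ ≠ 0 := by
      intro h
      have := (hS μ₀ hμ₀S).2
      rw [h, Multiset.sum_zero] at this
      omega
    obtain ⟨k₁, hk₁⟩ := Multiset.exists_mem_of_ne_zero hμ₀ne
    have hparts_ne : parts.Nonempty := ⟨k₁, Finset.mem_biUnion.2 ⟨μ₀, hμ₀S', Multiset.mem_toFinset.2 hk₁⟩⟩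
    set k₀ := parts.min' hparts_ne with hk₀def
    have hk₀mem : k₀ ∈ parts := Finset.min'_mem _ _
    obtain ⟨μ₁, hμ₁S', hk₀μ₁⟩ := Finset.mem_biUnion.1 hk₀mem
    rw [Multiset.mem_toFinset] at hk₀μ₁
    have hμ₁S : μ₁ ∈ S := (Finset.mem_filter.1 hμ₁S').1
    have hcμ₁ : c μ₁ ≠ 0 := (Finset.mem_filter.1 hμ₁S').2
    have hk₀pos : 0 < k₀ := (hS μ₁ hμ₁S).1 k₀ hk₀μ₁
    have hk₀le : ∀ μ ∈ S', ∀ l ∈ μ, k₀ ≤ l := fun μ hμ l hl =>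
      Finset.min'_le _ _ (Finset.mem_biUnion.2 ⟨μ, hμ, Multiset.mem_toFinset.2 hl⟩)
    have hk₀d : k₀ ≤ d := by
      have := Multiset.le_sum_of_mem hk₀μ₁
      rw [(hS μ₁ hμ₁S).2] at this
      exact this
    -- restrict the relation to `S'` and push it through `finSuccEquiv`, coefficient of `t^{k₀}`
    have hsum' : ∑ μ ∈ S', c μ • (μ.map (psum (Fin (n' + 1)) ℂ)).prod = 0 := by
      rw [hS'def, Finset.sum_filter_of_ne]
      · exact hsum
      · intro μ _ h; by_contra hc; rw [hc, zero_smul] at h; exact h rfl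
    have hmapped := congrArg (fun q => ((finSuccEquiv ℂ n') q).coeff k₀) hsum'
    simp only [map_sum, map_smul, map_multiset_prod, Multiset.map_map, Function.comp_def,
      finSuccEquiv_psum, map_zero, Polynomial.coeff_zero, Polynomial.finsetSum_coeff,
      Polynomial.coeff_smul] at hmapped
    have hcoef : ∀ μ ∈ S', ((μ.map fun l => (Polynomial.X ^ l + Polynomial.C (psum (Fin n') ℂ l) :
        Polynomial (MvPolynomial (Fin n') ℂ))).prod).coeff k₀ =
        (μ.count k₀ : MvPolynomial (Fin n') ℂ) * ((μ.erase k₀).map (psum (Fin n') ℂ)).prod :=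
      fun μ hμ => coeff_prod_X_pow_add_C (psum (Fin n') ℂ) k₀ hk₀pos μ (hk₀le μ hμ)
    rw [Finset.sum_congr rfl fun μ hμ => by rw [hcoef μ hμ]] at hmapped
    -- only the multisets containing `k₀` survive; re-index them by `μ ↦ μ.erase k₀`
    set S₁ : Finset (Multiset ℕ) := S'.filter fun μ => k₀ ∈ μ with hS₁def
    have hsum₁ : ∑ μ ∈ S₁, c μ • ((μ.count k₀ : MvPolynomial (Fin n') ℂ) *
        ((μ.erase k₀).map (psum (Fin n') ℂ)).prod) = 0 := by
      rw [hS₁def, Finset.sum_filter_of_ne]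
      · exact hmapped
      · intro μ _ h
        by_contra hk
        rw [Multiset.count_eq_zero_of_notMem hk, Nat.cast_zero, zero_mul, smul_zero] at h
        exact h rfl
    have hinj : Set.InjOn (fun μ : Multiset ℕ => μ.erase k₀) S₁ := by
      intro μ hμ μ' hμ' h
      have hk : k₀ ∈ μ := (Finset.mem_filter.1 hμ).2
      have hk' : k₀ ∈ μ' := (Finset.mem_filter.1 hμ').2
      simp only at h
      rw [← Multiset.cons_erase hk, ← Multiset.cons_erase hk', h]
    set T : Finset (Multiset ℕ) := S₁.image fun μ => μ.erase k₀ with hTdef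
    set c' : Multiset ℕ → ℂ := fun ν => c (k₀ ::ₘ ν) * ((k₀ ::ₘ ν).count k₀ : ℂ) with hc'def
    have hT : ∀ ν ∈ T, (∀ k ∈ ν, 0 < k) ∧ ν.sum = d - k₀ := by
      intro ν hν
      obtain ⟨μ, hμ, rfl⟩ := Finset.mem_image.1 hν
      have hμS : μ ∈ S := (Finset.mem_filter.1 (Finset.mem_filter.1 hμ).1).1
      have hk : k₀ ∈ μ := (Finset.mem_filter.1 hμ).2
      refine ⟨fun k hk' => (hS μ hμS).1 k (Multiset.mem_of_mem_erase hk'), ?_⟩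
      have h1 := (hS μ hμS).2
      rw [← Multiset.cons_erase hk, Multiset.sum_cons] at h1
      omega
    have hsumT : ∑ ν ∈ T, c' ν • (ν.map (psum (Fin n') ℂ)).prod = 0 := by
      rw [hTdef, Finset.sum_image hinj]
      rw [← hsum₁]
      refine Finset.sum_congr rfl fun μ hμ => ?_
      have hk : k₀ ∈ μ := (Finset.mem_filter.1 hμ).2
      simp only [hc'def, Multiset.cons_erase hk]
      rw [mul_smul]
      congr 1
      rw [smul_eq_C_mul, map_natCast]
    have hlt : d - k₀ < d := by omega
    have hle : d - k₀ ≤ n' := by omega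
    have hzero := ih (d - k₀) hlt n' hle T c' hT hsumT
    -- contradiction at `μ₁`
    have hμ₁S₁ : μ₁ ∈ S₁ := Finset.mem_filter.2 ⟨hμ₁S', hk₀μ₁⟩
    have h := hzero (μ₁.erase k₀) (Finset.mem_image.2 ⟨μ₁, hμ₁S₁, rfl⟩)
    simp only [hc'def, Multiset.cons_erase hk₀μ₁, mul_eq_zero, Nat.cast_eq_zero] at h
    rcases h with h | h
    · exact hcμ₁ h
    · exact (Multiset.count_pos.2 hk₀μ₁).ne' h

/-! ### Spanning: symmetric homogeneous polynomials are combinations of power-sum products -/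

/-- The power sum `p_k` is homogeneous of degree `k`. [folklore] -/
theorem psum_isHomogeneous (n k : ℕ) : (psum (Fin n) ℂ k).IsHomogeneous k := by
  unfold psum
  exact IsHomogeneous.sum _ _ _ fun i _ => by simpa using (isHomogeneous_X ℂ i).pow k

/-- A product of power sums `Π_{k ∈ μ} p_k` is homogeneous of degree `μ.sum`. [folklore] -/
theorem psumProd_isHomogeneous (n : ℕ) : ∀ μ : Multiset ℕ,
    ((μ.map (psum (Fin n) ℂ)).prod).IsHomogeneous μ.sum := by
  intro μ
  induction μ using Multiset.induction_on with
  | empty => simpa using isHomogeneous_one (Fin n) ℂ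
  | cons k μ ih =>
    rw [Multiset.map_cons, Multiset.prod_cons, Multiset.sum_cons]
    exact (psum_isHomogeneous n k).mul ih

/-- Newton's identities, subalgebra form: every elementary symmetric polynomial `e_k` lies in the subalgebra
generated by the positive power sums `p_1, p_2, …` (strong induction on `k` from Mathlib's `mul_esymm_eq_sum`,
dividing by `k` in characteristic `0`). [folklore] -/
theorem esymm_mem_adjoin_range_psum_succ (n k : ℕ) :
    esymm (Fin n) ℂ k ∈ Algebra.adjoin ℂ (Set.range fun j : ℕ => psum (Fin n) ℂ (j + 1)) := by
  induction k using Nat.strong_induction_on with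
  | _ k ih =>
    rcases Nat.eq_zero_or_pos k with rfl | hpos
    · rw [esymm_zero]
      exact Subalgebra.one_mem _
    have hk0 : (k : ℂ) ≠ 0 := Nat.cast_ne_zero.mpr hpos.ne'
    have key := MvPolynomial.mul_esymm_eq_sum (Fin n) ℂ k
    have hCk : esymm (Fin n) ℂ k =
        (k : ℂ)⁻¹ • ((k : MvPolynomial (Fin n) ℂ) * esymm (Fin n) ℂ k) := by
      rw [smul_eq_C_mul, ← mul_assoc,
        show (k : MvPolynomial (Fin n) ℂ) = C (k : ℂ) from (map_natCast C k).symm,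
        ← map_mul, inv_mul_cancel₀ hk0, C_1, one_mul]
    have hneg : ∀ i : ℕ, (-1 : MvPolynomial (Fin n) ℂ) ^ i ∈
        Algebra.adjoin ℂ (Set.range fun j : ℕ => psum (Fin n) ℂ (j + 1)) := fun i =>
      Subalgebra.pow_mem _ (Subalgebra.neg_mem _ (Subalgebra.one_mem _)) _
    rw [hCk, key]
    refine Subalgebra.smul_mem _ (Subalgebra.mul_mem _ (hneg _)
      (Subalgebra.sum_mem _ fun a ha => ?_)) _
    rw [Finset.mem_filter, Finset.HasAntidiagonal.mem_antidiagonal] at ha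
    obtain ⟨hab, halt⟩ := ha
    refine Subalgebra.mul_mem _ (Subalgebra.mul_mem _ (hneg _) (ih a.1 halt)) ?_
    have hj : a.2 = (a.2 - 1) + 1 := by omega
    rw [hj]
    exact Algebra.subset_adjoin ⟨a.2 - 1, rfl⟩

/-- Every element of the monoid generated by the positive power sums is a power-sum product `Π_{k ∈ μ} p_k` over a
multiset of positive integers. [folklore] -/
theorem exists_multiset_of_mem_closure_psum (n : ℕ) {x : MvPolynomial (Fin n) ℂ}
    (hx : x ∈ Submonoid.closure (Set.range fun j : ℕ => psum (Fin n) ℂ (j + 1))) :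
    ∃ μ : Multiset ℕ, (∀ k ∈ μ, 0 < k) ∧ (μ.map (psum (Fin n) ℂ)).prod = x := by
  suffices h : ∀ l : Multiset (MvPolynomial (Fin n) ℂ),
      (∀ y ∈ l, y ∈ Set.range fun j : ℕ => psum (Fin n) ℂ (j + 1)) →
      ∃ μ : Multiset ℕ, (∀ k ∈ μ, 0 < k) ∧ (μ.map (psum (Fin n) ℂ)).prod = l.prod by
    obtain ⟨l, hl, rfl⟩ := Submonoid.exists_multiset_of_mem_closure hx
    exact h l hl
  intro l
  induction l using Multiset.induction_on with
  | empty => intro _; exact ⟨0, by simp, by simp⟩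
  | cons y l ih =>
    intro hl
    obtain ⟨μ, hμpos, hμ⟩ := ih fun z hz => hl z (Multiset.mem_cons_of_mem hz)
    obtain ⟨j, hj⟩ := hl y (Multiset.mem_cons_self _ _)
    refine ⟨(j + 1) ::ₘ μ, ?_, ?_⟩
    · intro k hk
      rcases Multiset.mem_cons.1 hk with rfl | hk
      · omega
      · exact hμpos k hk
    · rw [Multiset.map_cons, Multiset.prod_cons, hμ, ← hj, Multiset.prod_cons]

/-- **Spanning.**  A symmetric polynomial in `n` variables over `ℂ`, homogeneous of degree `d`, is a `ℂ`-linear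
combination of power-sum products `Π_{k ∈ μ} p_k` over multisets `μ` of positive integers with `μ.sum = d`
(fundamental theorem of symmetric polynomials + Newton's identities + homogeneity). [folklore] -/
theorem exists_psumProd_expansion (n d : ℕ) (p : MvPolynomial (Fin n) ℂ) (hs : p.IsSymmetric)
    (hh : p.IsHomogeneous d) :
    ∃ (m : ℕ) (μ : Fin m → Multiset ℕ) (c : Fin m → ℂ),
      (∀ i, (∀ k ∈ μ i, 0 < k) ∧ (μ i).sum = d) ∧
      p = ∑ i, c i • ((μ i).map (psum (Fin n) ℂ)).prod := by
  classical
  -- Step 1: `p` lies in the subalgebra generated by the positive power sums.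
  set A : Subalgebra ℂ (MvPolynomial (Fin n) ℂ) :=
    Algebra.adjoin ℂ (Set.range fun j : ℕ => psum (Fin n) ℂ (j + 1)) with hAdef
  have hpA : p ∈ A := by
    have hmem : p ∈ symmetricSubalgebra (Fin n) ℂ := (mem_symmetricSubalgebra p).2 hs
    obtain ⟨q, hq⟩ := esymmAlgHom_surjective ℂ (σ := Fin n) (n := n) (by simp) ⟨p, hmem⟩
    have hpq : p = aeval (fun i : Fin n => esymm (Fin n) ℂ ((i : ℕ) + 1)) q := by
      have := congrArg Subtype.val hq
      rw [esymmAlgHom_apply] at this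
      exact this.symm
    rw [hpq]
    have hrange : (aeval (fun i : Fin n => esymm (Fin n) ℂ ((i : ℕ) + 1))).range ≤ A := by
      rw [← Algebra.adjoin_range_eq_range_aeval]
      refine Algebra.adjoin_le ?_
      rintro _ ⟨i, rfl⟩
      exact esymm_mem_adjoin_range_psum_succ n _
    exact hrange ⟨q, rfl⟩
  -- Step 2: hence a combination of monomials in the power sums, i.e. of power-sum products.
  have hspan : p ∈ Submodule.span ℂ
      (Submonoid.closure (Set.range fun j : ℕ => psum (Fin n) ℂ (j + 1)) :
        Set (MvPolynomial (Fin n) ℂ)) := by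
    rw [← Algebra.adjoin_eq_span]
    exact hpA
  obtain ⟨g, t, hts, -, hsum⟩ := Submodule.mem_span_iff_exists_finset_subset.1 hspan
  -- choose a multiset of positive parts for every element of `t`
  have hchoice : ∀ x ∈ t, ∃ μ : Multiset ℕ, (∀ k ∈ μ, 0 < k) ∧ (μ.map (psum (Fin n) ℂ)).prod = x :=
    fun x hx => exists_multiset_of_mem_closure_psum n (hts hx)
  choose! ν hνpos hνprod using hchoice
  -- Step 3: filter by homogeneous degree.
  have hp' : p = ∑ x ∈ t, g x • ((ν x).map (psum (Fin n) ℂ)).prod := by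
    rw [← hsum]
    exact Finset.sum_congr rfl fun x hx => by rw [hνprod x hx]
  have hp'' : p = ∑ x ∈ t.filter (fun x => (ν x).sum = d), g x • ((ν x).map (psum (Fin n) ℂ)).prod := by
    have hcomp := homogeneousComponent_eq_self hh
    rw [← hcomp]
    conv_lhs => rw [hp']
    rw [map_sum, Finset.sum_filter]
    refine Finset.sum_congr rfl fun x hx => ?_
    rw [map_smul, homogeneousComponent_of_mem (psumProd_isHomogeneous n (ν x))]
    by_cases hxd : (ν x).sum = d
    · rw [if_pos hxd, if_pos hxd.symm]
    · rw [if_neg hxd, if_neg (Ne.symm hxd), smul_zero]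
  -- Step 4: re-index by `Fin m`.
  set t' := t.filter (fun x => (ν x).sum = d) with ht'def
  refine ⟨t'.card, fun i => ν (t'.equivFin.symm i), fun i => g (t'.equivFin.symm i), ?_, ?_⟩
  · intro i
    have hi : ((t'.equivFin.symm i) : MvPolynomial (Fin n) ℂ) ∈ t' := (t'.equivFin.symm i).2
    exact ⟨hνpos _ (Finset.mem_filter.1 hi).1, (Finset.mem_filter.1 hi).2⟩
  · rw [hp'', ← Finset.sum_coe_sort t']
    exact (Fintype.sum_equiv t'.equivFin.symm _ _ fun i => rfl).symm

end Summit.ValiantsHypothesis.ValiantsHypothesis.Theorems.SmlPowerSums
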